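import Summits.AtomisticToContinuum.Crystallization.Theorems.SquareWellLayerCakeGapTwelveToBarlowCombinatorialLayeringTransportSteps5
import Summits.AtomisticToContinuum.Crystallization.Theorems.SquareWellLayerCakeGapTwelveToBarlowCombinatorialLayeringTransportLayerZero
import Summits.AtomisticToContinuum.Crystallization.Theorems.SquareWellLayerCakeGapTwelveToBarlowCombinatorialLayeringTransportGlobalB
import Summits.AtomisticToContinuum.Crystallization.Theorems.SquareWellLayerCakeGapTwelveToBarlowCombinatorialLayeringTransportFiniteLines
import Summits.AtomisticToContinuum.Crystallization.Theorems.PalmUnimodularRigidityShellsToBarlowChartTransportGlobalB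

/-!
# Combinatorial layering (B1a of `GapTwelveToBarlow`): the finite base plane of frames

Crux `SquareWellLayerCake.GapTwelveToBarlow` (stmt-AtomisticToContinuum-15807), line `Sketch`,
stub `stub_combinatorialLayering`, residual `(H_develop)`; second piece of the FINITE DEVELOPMENT:
the graded analogue of 9227's `layer_zero` (`…TransportGlobalB`).  From a valid frame `g₀` of
parity `+1` in the base regime at level `n + 3 + R`, the grid
`G i j := zIter I I⁻¹ i (zIter J J⁻¹ j g₀)` is defined for `|j| + |i| ≤ R`, valid, of parity `+1`,
in the base regime, at level `n + 3 + (R − |j| − |i|)`, and COHERENT: `G (i+1) j = I (G i j)` and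
`G i (j+1) = J (G i j)` inside the range — the latter by induction on `i` from the `J`-line
through `g₀`, using `I ∘ J = J ∘ I` (`Istep_Jstep_comm`, the landed `…TransportLayerZero`) upward
and `I⁻¹ (J (I h)) = J h` downward (`down_IJ`), which is where the margin `3` in the level is
spent.  `ℤ`-indexed forms of the finite lines (`lineFin_I_int`, `lineFin_J_int`) come first.
All `[folklore]`.
-/

noncomputable section

namespace Summit.AtomisticToContinuum.Crystallization.Theorems.SquareWellLayerCakeGapTwelveToBarlow

open Literature.Geometry.DiscreteGeometry Literature.MathematicalPhysics.StatisticalMechanics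
open Summit.AtomisticToContinuum.Crystallization.Theorems.PalmUnimodularRigidityShellsToBarlowChart hiding
  IsZChart TransportSystem scales_tied sqNormInt_transfer bond_symm nb_mem zlab_spec zlab_nb
  bond_nb_iff pattern_cases transfer_nb_nb transfer_nb_centre transfer_nb_target
  sqNormInt_zlab_centre hcp_of_mirror_pair Istep_spec Jstep_spec IinvStep_spec JinvStep_spec
  capWithAny_of_mem_cap IinvStep_Istep Istep_IinvStep JinvStep_Jstep Jstep_JinvStep polar_at_apex
  onesided_at_apex Vstep_spec nb_inj Istep_lower Jstep_lower IinvStep_lower JinvStep_lower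
  polar_at_lower_apex onesided_at_lower_apex VinvStep_spec attach_I_even attach_I_odd
  attach_lower_I_pos attach_lower_I_neg attach_J_even attach_J_odd Vstep_Istep_pt Vstep_Istep_back
  Vstep_Istep_side Vstep_Jstep_pt Vstep_Istep_comm Vstep_Jstep_comm attach_lower_J_pos
  attach_lower_J_neg VinvStep_Istep_pt VinvStep_Jstep_pt VinvStep_Istep_back VinvStep_Istep_side
  VinvStep_Istep_comm VinvStep_Jstep_comm Istep_Jstep_comm line_I line_J adm_transports layer_zero

variable {S : ℕ → Set (EuclideanSpace ℝ (Fin 3))}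
  {B : EuclideanSpace ℝ (Fin 3) → EuclideanSpace ℝ (Fin 3) → Prop}
  {Pc : EuclideanSpace ℝ (Fin 3) → Finset (Fin 3 → ℤ)}
  {nb : EuclideanSpace ℝ (Fin 3) → (Fin 3 → ℤ) → EuclideanSpace ℝ (Fin 3)}

variable
  (hch : (∀ n : ℕ, ∀ z ∈ S n, (Pc z = fcc3Int ∨ Pc z = hcpInt) ∧
      Set.BijOn (nb z) (↑(Pc z) : Set (Fin 3 → ℤ)) {y | B z y} ∧
      ∀ t ∈ Pc z, ∀ t' ∈ Pc z, (B (nb z t) (nb z t') ↔ sqNormInt (t - t') = 18)) ∧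
    (∀ n : ℕ, ∀ z ∈ S (n + 1), ∀ y, B z y → y ∈ S n) ∧
    (∀ n m : ℕ, ∀ x ∈ S n, ∀ y ∈ S m, B x y →
      ∀ (z z' : EuclideanSpace ℝ (Fin 3)) (t t' u u' : Fin 3 → ℤ),
        (t = 0 ∧ z = x ∨ t ∈ Pc x ∧ z = nb x t) → (t' = 0 ∧ z' = x ∨ t' ∈ Pc x ∧ z' = nb x t') →
        (u = 0 ∧ z = y ∨ u ∈ Pc y ∧ z = nb y u) → (u' = 0 ∧ z' = y ∨ u' ∈ Pc y ∧ z' = nb y u') →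
        sqNormInt (u - u') = sqNormInt (t - t')) ∧
    (∀ x y, B x y → B y x))

include hch


/-! ## Commuting `I` past `J` at an admissible frame -/

/-- Upward: `I (J g) = J (I g)` at a valid frame of parity `+1` in the base regime, three levels
deep. [folklore] -/
theorem up_IJ {ℓ : ℕ} (g : ZFrame) (hg : IsFrame (Pc g.pt) g.t₁ g.t₂ g.U) (hgS : g.pt ∈ S (ℓ + 3))
    (hp : frameParity g.t₁ g.t₂ g.U = 1) (hA : (∀ m, ∀ z ∈ S m, Pc z = fcc3Int) ∨ Pc g.pt = hcpInt) :
    Istep Pc nb (Jstep Pc nb g) = Jstep Pc nb (Istep Pc nb g) := by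
  obtain ⟨x, t₁, t₂, U⟩ := g
  obtain ⟨hI, hJ, hIi, hJi, -⟩ := adm_transports hch hgS hg hA
  exact Istep_Jstep_comm hch hgS hg hp hA hI hJ hIi hJi

/-- Downward: `I⁻¹ (J (I h)) = J h` at a valid frame of parity `+1` in the base regime, three
levels deep. [folklore] -/
theorem down_IJ {ℓ : ℕ} (h : ZFrame) (hh : IsFrame (Pc h.pt) h.t₁ h.t₂ h.U) (hhS : h.pt ∈ S (ℓ + 3))
    (hp : frameParity h.t₁ h.t₂ h.U = 1) (hA : (∀ m, ∀ z ∈ S m, Pc z = fcc3Int) ∨ Pc h.pt = hcpInt) :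
    IinvStep Pc nb (Jstep Pc nb (Istep Pc nb h)) = Jstep Pc nb h := by
  obtain ⟨x, t₁, t₂, U⟩ := h
  obtain ⟨hI, hJ, hIi, hJi, hAJ⟩ := adm_transports hch hhS hh hA
  rw [← Istep_Jstep_comm hch hhS hh hp hA hI hJ hIi hJi]
  rcases hJeq : Jstep Pc nb ⟨x, t₁, t₂, U⟩ with ⟨y, a, b, W⟩
  have hyS : y ∈ S (ℓ + 2) := by
    have ht₂ : t₂ ∈ Pc x := hh.2.1 (mem_hexLabels_iff.2 (Or.inr (Or.inl rfl)))
    have := (nb_mem hch hhS ht₂).1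
    rw [show nb x t₂ = y from congrArg ZFrame.pt hJeq] at this; exact this
  have hW : IsFrame (Pc y) a b W := by
    rw [hJeq, show nb x t₂ = y from congrArg ZFrame.pt hJeq] at hJ; exact hJ
  have hAy : (∀ m, ∀ z ∈ S m, Pc z = fcc3Int) ∨ Pc y = hcpInt := by
    rw [show nb x t₂ = y from congrArg ZFrame.pt hJeq] at hAJ; exact hAJ
  obtain ⟨hI', -, -, -, -⟩ := adm_transports hch hyS hW hAy
  exact IinvStep_Istep hch hyS hW (hregI_of_valid (Pc := Pc) (nb := nb) hI')

/-! ## `ℤ`-indexed finite lines -/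

/-- **Finite `I`-line, `ℤ`-indexed.** [folklore] -/
theorem lineFin_I_int {n R : ℕ} {g₀ : ZFrame} (h₀ : IsFrame (Pc g₀.pt) g₀.t₁ g₀.t₂ g₀.U)
    (h₀S : g₀.pt ∈ S (n + R)) (h₀p : frameParity g₀.t₁ g₀.t₂ g₀.U = 1)
    (h₀A : (∀ m, ∀ z ∈ S m, Pc z = fcc3Int) ∨ Pc g₀.pt = hcpInt) :
    ∀ k : ℤ, k.natAbs ≤ R →
      (IsFrame (Pc (zIter (Istep Pc nb) (IinvStep Pc nb) k g₀).pt) (zIter (Istep Pc nb) (IinvStep Pc nb) k g₀).t₁ (zIter (Istep Pc nb) (IinvStep Pc nb) k g₀).t₂ (zIter (Istep Pc nb) (IinvStep Pc nb) k g₀).U ∧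
        (zIter (Istep Pc nb) (IinvStep Pc nb) k g₀).pt ∈ S (n + (R - k.natAbs)) ∧ frameParity (zIter (Istep Pc nb) (IinvStep Pc nb) k g₀).t₁ (zIter (Istep Pc nb) (IinvStep Pc nb) k g₀).t₂ (zIter (Istep Pc nb) (IinvStep Pc nb) k g₀).U = 1 ∧ ((∀ m', ∀ z ∈ S m', Pc z = fcc3Int) ∨ Pc (zIter (Istep Pc nb) (IinvStep Pc nb) k g₀).pt = hcpInt)) ∧
      (k.natAbs + 1 ≤ R → zIter (Istep Pc nb) (IinvStep Pc nb) (k + 1) g₀ = Istep Pc nb (zIter (Istep Pc nb) (IinvStep Pc nb) k g₀)) := by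
  intro k hk
  rcases int_cases k with ⟨m, rfl⟩ | ⟨m, rfl⟩
  · rw [Int.natAbs_natCast] at hk ⊢
    exact ⟨lineFin_I_fwd hch h₀ h₀S h₀p h₀A m hk, fun _ => zIter_natSucc _ _ m g₀⟩
  · have habs : (-((m : ℤ) + 1)).natAbs = m + 1 := by
      rw [Int.natAbs_neg]; exact Int.natAbs_natCast (m + 1)
    rw [habs] at hk ⊢
    refine ⟨?_, fun _ => ?_⟩
    · have := (lineFin_I_bwd hch h₀ h₀S h₀p h₀A (m + 1) hk).1
      push_cast at this
      exact this
    · have := (lineFin_I_bwd hch h₀ h₀S h₀p h₀A m (by omega)).2 (by omega)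
      rw [show -((m : ℤ) + 1) + 1 = -(m : ℤ) by ring]
      exact this

/-- **Finite `J`-line, `ℤ`-indexed.** [folklore] -/
theorem lineFin_J_int {n R : ℕ} {g₀ : ZFrame} (h₀ : IsFrame (Pc g₀.pt) g₀.t₁ g₀.t₂ g₀.U)
    (h₀S : g₀.pt ∈ S (n + R)) (h₀p : frameParity g₀.t₁ g₀.t₂ g₀.U = 1)
    (h₀A : (∀ m, ∀ z ∈ S m, Pc z = fcc3Int) ∨ Pc g₀.pt = hcpInt) :
    ∀ k : ℤ, k.natAbs ≤ R →
      (IsFrame (Pc (zIter (Jstep Pc nb) (JinvStep Pc nb) k g₀).pt) (zIter (Jstep Pc nb) (JinvStep Pc nb) k g₀).t₁ (zIter (Jstep Pc nb) (JinvStep Pc nb) k g₀).t₂ (zIter (Jstep Pc nb) (JinvStep Pc nb) k g₀).U ∧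
        (zIter (Jstep Pc nb) (JinvStep Pc nb) k g₀).pt ∈ S (n + (R - k.natAbs)) ∧ frameParity (zIter (Jstep Pc nb) (JinvStep Pc nb) k g₀).t₁ (zIter (Jstep Pc nb) (JinvStep Pc nb) k g₀).t₂ (zIter (Jstep Pc nb) (JinvStep Pc nb) k g₀).U = 1 ∧ ((∀ m', ∀ z ∈ S m', Pc z = fcc3Int) ∨ Pc (zIter (Jstep Pc nb) (JinvStep Pc nb) k g₀).pt = hcpInt)) ∧
      (k.natAbs + 1 ≤ R → zIter (Jstep Pc nb) (JinvStep Pc nb) (k + 1) g₀ = Jstep Pc nb (zIter (Jstep Pc nb) (JinvStep Pc nb) k g₀)) := by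
  intro k hk
  rcases int_cases k with ⟨m, rfl⟩ | ⟨m, rfl⟩
  · rw [Int.natAbs_natCast] at hk ⊢
    exact ⟨lineFin_J_fwd hch h₀ h₀S h₀p h₀A m hk, fun _ => zIter_natSucc _ _ m g₀⟩
  · have habs : (-((m : ℤ) + 1)).natAbs = m + 1 := by
      rw [Int.natAbs_neg]; exact Int.natAbs_natCast (m + 1)
    rw [habs] at hk ⊢
    refine ⟨?_, fun _ => ?_⟩
    · have := (lineFin_J_bwd hch h₀ h₀S h₀p h₀A (m + 1) hk).1
      push_cast at this
      exact this
    · have := (lineFin_J_bwd hch h₀ h₀S h₀p h₀A m (by omega)).2 (by omega)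
      rw [show -((m : ℤ) + 1) + 1 = -(m : ℤ) by ring]
      exact this

/-! ## The finite base plane -/

/-- **The finite base plane** (graded `layer_zero`): validity, level, parity, regime of the grid
frames `G i j = zIter I I⁻¹ i (zIter J J⁻¹ j g₀)` for `|j| + |i| ≤ R`, and the two coherences
`G (i+1) j = I (G i j)`, `G i (j+1) = J (G i j)` inside the range. [folklore] -/
theorem planeFin {n R : ℕ} {g₀ : ZFrame} (h₀ : IsFrame (Pc g₀.pt) g₀.t₁ g₀.t₂ g₀.U)
    (h₀S : g₀.pt ∈ S (n + 3 + R)) (h₀p : frameParity g₀.t₁ g₀.t₂ g₀.U = 1)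
    (h₀A : (∀ m, ∀ z ∈ S m, Pc z = fcc3Int) ∨ Pc g₀.pt = hcpInt) :
    (∀ i j : ℤ, j.natAbs + i.natAbs ≤ R →
      IsFrame (Pc (zIter (Istep Pc nb) (IinvStep Pc nb) i (zIter (Jstep Pc nb) (JinvStep Pc nb) j g₀)).pt) (zIter (Istep Pc nb) (IinvStep Pc nb) i (zIter (Jstep Pc nb) (JinvStep Pc nb) j g₀)).t₁ (zIter (Istep Pc nb) (IinvStep Pc nb) i (zIter (Jstep Pc nb) (JinvStep Pc nb) j g₀)).t₂ (zIter (Istep Pc nb) (IinvStep Pc nb) i (zIter (Jstep Pc nb) (JinvStep Pc nb) j g₀)).U ∧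
        (zIter (Istep Pc nb) (IinvStep Pc nb) i (zIter (Jstep Pc nb) (JinvStep Pc nb) j g₀)).pt ∈ S (n + 3 + (R - j.natAbs - i.natAbs)) ∧
        frameParity (zIter (Istep Pc nb) (IinvStep Pc nb) i (zIter (Jstep Pc nb) (JinvStep Pc nb) j g₀)).t₁ (zIter (Istep Pc nb) (IinvStep Pc nb) i (zIter (Jstep Pc nb) (JinvStep Pc nb) j g₀)).t₂ (zIter (Istep Pc nb) (IinvStep Pc nb) i (zIter (Jstep Pc nb) (JinvStep Pc nb) j g₀)).U = 1 ∧ ((∀ m', ∀ z ∈ S m', Pc z = fcc3Int) ∨ Pc (zIter (Istep Pc nb) (IinvStep Pc nb) i (zIter (Jstep Pc nb) (JinvStep Pc nb) j g₀)).pt = hcpInt)) ∧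
    (∀ i j : ℤ, j.natAbs + i.natAbs + 1 ≤ R →
      zIter (Istep Pc nb) (IinvStep Pc nb) (i + 1) (zIter (Jstep Pc nb) (JinvStep Pc nb) j g₀) = Istep Pc nb (zIter (Istep Pc nb) (IinvStep Pc nb) i (zIter (Jstep Pc nb) (JinvStep Pc nb) j g₀))) ∧
    (∀ i j : ℤ, j.natAbs + 1 + i.natAbs ≤ R →
      zIter (Istep Pc nb) (IinvStep Pc nb) i (zIter (Jstep Pc nb) (JinvStep Pc nb) (j + 1) g₀) = Jstep Pc nb (zIter (Istep Pc nb) (IinvStep Pc nb) i (zIter (Jstep Pc nb) (JinvStep Pc nb) j g₀))) := by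
  -- the J-line through g₀ (columns) and the I-lines through its frames (rows)
  have col := lineFin_J_int hch (n := n + 3) (R := R) h₀ h₀S h₀p h₀A
  have row : ∀ j : ℤ, j.natAbs ≤ R → ∀ i : ℤ, i.natAbs ≤ R - j.natAbs →
      (IsFrame (Pc (zIter (Istep Pc nb) (IinvStep Pc nb) i (zIter (Jstep Pc nb) (JinvStep Pc nb) j g₀)).pt) (zIter (Istep Pc nb) (IinvStep Pc nb) i (zIter (Jstep Pc nb) (JinvStep Pc nb) j g₀)).t₁ (zIter (Istep Pc nb) (IinvStep Pc nb) i (zIter (Jstep Pc nb) (JinvStep Pc nb) j g₀)).t₂ (zIter (Istep Pc nb) (IinvStep Pc nb) i (zIter (Jstep Pc nb) (JinvStep Pc nb) j g₀)).U ∧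
        (zIter (Istep Pc nb) (IinvStep Pc nb) i (zIter (Jstep Pc nb) (JinvStep Pc nb) j g₀)).pt ∈ S (n + 3 + (R - j.natAbs - i.natAbs)) ∧
        frameParity (zIter (Istep Pc nb) (IinvStep Pc nb) i (zIter (Jstep Pc nb) (JinvStep Pc nb) j g₀)).t₁ (zIter (Istep Pc nb) (IinvStep Pc nb) i (zIter (Jstep Pc nb) (JinvStep Pc nb) j g₀)).t₂ (zIter (Istep Pc nb) (IinvStep Pc nb) i (zIter (Jstep Pc nb) (JinvStep Pc nb) j g₀)).U = 1 ∧ ((∀ m', ∀ z ∈ S m', Pc z = fcc3Int) ∨ Pc (zIter (Istep Pc nb) (IinvStep Pc nb) i (zIter (Jstep Pc nb) (JinvStep Pc nb) j g₀)).pt = hcpInt)) ∧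
      (i.natAbs + 1 ≤ R - j.natAbs → zIter (Istep Pc nb) (IinvStep Pc nb) (i + 1) (zIter (Jstep Pc nb) (JinvStep Pc nb) j g₀) = Istep Pc nb (zIter (Istep Pc nb) (IinvStep Pc nb) i (zIter (Jstep Pc nb) (JinvStep Pc nb) j g₀))) := by
    intro j hj i hi
    obtain ⟨⟨c1, c2, c3, c4⟩, -⟩ := col j hj
    have e : n + 3 + (R - j.natAbs) = (n + 3) + (R - j.natAbs) := rfl
    have := lineFin_I_int hch (n := n + 3) (R := R - j.natAbs) c1 c2 c3 c4 i hi
    rwa [show n + 3 + (R - j.natAbs - i.natAbs) = n + 3 + (R - j.natAbs - i.natAbs) from rfl,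
      Nat.sub_sub] at this ⊢
  refine ⟨fun i j h => (row j (by omega) i (by omega)).1, fun i j h => (row j (by omega) i (by omega)).2 (by omega), ?_⟩
  -- coherence along `J`, by induction on `i`
  intro i j hij
  have hnat : ∀ m : ℕ, j.natAbs + 1 + m ≤ R →
      zIter (Istep Pc nb) (IinvStep Pc nb) (m : ℤ) (zIter (Jstep Pc nb) (JinvStep Pc nb) (j + 1) g₀) = Jstep Pc nb (zIter (Istep Pc nb) (IinvStep Pc nb) (m : ℤ) (zIter (Jstep Pc nb) (JinvStep Pc nb) j g₀)) := by
    intro m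
    induction m with
    | zero =>
      intro hm
      exact (col j (by omega)).2 (by omega)
    | succ m ih =>
      intro hm
      push_cast
      rw [zIter_natSucc, zIter_natSucc, ih (by omega)]
      obtain ⟨⟨h1, h2, h3, h4⟩, -⟩ := row j (by omega) (m : ℤ) (by rw [Int.natAbs_natCast]; omega)
      rw [Int.natAbs_natCast] at h2
      have el : n + 3 + (R - j.natAbs - m) = (n + (R - j.natAbs - m)) + 3 := by omega
      rw [el] at h2
      exact up_IJ hch _ h1 h2 h3 h4
  have hneg : ∀ m : ℕ, j.natAbs + 1 + m ≤ R →
      zIter (Istep Pc nb) (IinvStep Pc nb) (-(m : ℤ)) (zIter (Jstep Pc nb) (JinvStep Pc nb) (j + 1) g₀) = Jstep Pc nb (zIter (Istep Pc nb) (IinvStep Pc nb) (-(m : ℤ)) (zIter (Jstep Pc nb) (JinvStep Pc nb) j g₀)) := by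
    intro m
    induction m with
    | zero => intro hm; simpa using hnat 0 hm
    | succ m ih =>
      intro hm
      push_cast
      rw [zIter_negSucc', ih (by omega)]
      obtain ⟨⟨h1, h2, h3, h4⟩, hrel⟩ := row j (by omega) (-((m : ℤ) + 1))
        (by rw [Int.natAbs_neg, show ((m : ℤ) + 1) = ((m + 1 : ℕ) : ℤ) by push_cast; ring,
          Int.natAbs_natCast]; omega)
      have habs : (-((m : ℤ) + 1)).natAbs = m + 1 := by
        rw [Int.natAbs_neg, show ((m : ℤ) + 1) = ((m + 1 : ℕ) : ℤ) by push_cast; ring, Int.natAbs_natCast]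
      rw [habs] at h2 hrel
      rw [show -((m : ℤ) + 1) + 1 = -(m : ℤ) by ring] at hrel
      rw [hrel (by omega)]
      have el : n + 3 + (R - j.natAbs - (m + 1)) = (n + (R - j.natAbs - (m + 1))) + 3 := by omega
      rw [el] at h2
      exact down_IJ hch _ h1 h2 h3 h4
  rcases int_cases i with ⟨m, rfl⟩ | ⟨m, rfl⟩
  · rw [Int.natAbs_natCast] at hij
    exact hnat m (by omega)
  · have habs : (-((m : ℤ) + 1)).natAbs = m + 1 := by
      rw [Int.natAbs_neg, show ((m : ℤ) + 1) = ((m + 1 : ℕ) : ℤ) by push_cast; ring, Int.natAbs_natCast]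
    rw [habs] at hij
    have := hneg (m + 1) (by omega)
    push_cast at this
    exact this

/-! ## Registered anchor (closed form) -/

omit hch in
/-- **Closed form of `up_IJ`** (the registered anchor of this file): the section data
`S, B, Pc, nb` and the standing hypothesis written out (two hypotheses regrouped). [folklore] -/
theorem up_IJ_graded :
    ∀ {S : ℕ → Set (EuclideanSpace ℝ (Fin 3))} {B : EuclideanSpace ℝ (Fin 3) → EuclideanSpace ℝ
    (Fin 3) → Prop} {Pc : EuclideanSpace ℝ (Fin 3) → Finset (Fin 3 → ℤ)} {nb : EuclideanSpace ℝ
    (Fin 3) → (Fin 3 → ℤ) → EuclideanSpace ℝ (Fin 3)}, ((∀ n : ℕ, ∀ z ∈ S n, (Pc z =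
    Summit.AtomisticToContinuum.Crystallization.Theorems.PalmUnimodularRigidityShellsToBarlowChart.fcc3Int
    ∨ Pc z = Literature.Geometry.DiscreteGeometry.hcpInt) ∧ Set.BijOn (nb z) (↑(Pc z) : Set (Fin
    3 → ℤ)) {y | B z y} ∧ ∀ t ∈ Pc z, ∀ t' ∈ Pc z, (B (nb z t) (nb z t') ↔
    Literature.Geometry.DiscreteGeometry.sqNormInt (t - t') = 18)) ∧ (∀ n : ℕ, ∀ z ∈ S (n + 1),
    ∀ y, B z y → y ∈ S n) ∧ (∀ n m : ℕ, ∀ x ∈ S n, ∀ y ∈ S m, B x y → ∀ (z z' : EuclideanSpace ℝ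
    (Fin 3)) (t t' u u' : Fin 3 → ℤ), (t = 0 ∧ z = x ∨ t ∈ Pc x ∧ z = nb x t) → (t' = 0 ∧ z' = x
    ∨ t' ∈ Pc x ∧ z' = nb x t') → (u = 0 ∧ z = y ∨ u ∈ Pc y ∧ z = nb y u) → (u' = 0 ∧ z' = y ∨
    u' ∈ Pc y ∧ z' = nb y u') → Literature.Geometry.DiscreteGeometry.sqNormInt (u - u') =
    Literature.Geometry.DiscreteGeometry.sqNormInt (t - t')) ∧ (∀ x y, B x y → B y x)) → ∀ {ℓ :
    ℕ} (g :
    Summit.AtomisticToContinuum.Crystallization.Theorems.PalmUnimodularRigidityShellsToBarlowChart.ZFrame),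
    g.pt ∈ S (ℓ + 3) →
    Summit.AtomisticToContinuum.Crystallization.Theorems.PalmUnimodularRigidityShellsToBarlowChart.IsFrame
    (Pc g.pt) g.t₁ g.t₂ g.U →
    Summit.AtomisticToContinuum.Crystallization.Theorems.PalmUnimodularRigidityShellsToBarlowChart.frameParity
    g.t₁ g.t₂ g.U = 1 → (∀ m, ∀ z ∈ S m, Pc z =
    Summit.AtomisticToContinuum.Crystallization.Theorems.PalmUnimodularRigidityShellsToBarlowChart.fcc3Int)
    ∨ Pc g.pt = Literature.Geometry.DiscreteGeometry.hcpInt →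
    Summit.AtomisticToContinuum.Crystallization.Theorems.PalmUnimodularRigidityShellsToBarlowChart.Istep
    Pc nb
    (Summit.AtomisticToContinuum.Crystallization.Theorems.PalmUnimodularRigidityShellsToBarlowChart.Jstep
    Pc nb g) =
    Summit.AtomisticToContinuum.Crystallization.Theorems.PalmUnimodularRigidityShellsToBarlowChart.Jstep
    Pc nb
    (Summit.AtomisticToContinuum.Crystallization.Theorems.PalmUnimodularRigidityShellsToBarlowChart.Istep
    Pc nb g) := by
  intro S B Pc nb hch ℓ g hgS hg hp hA
  exact up_IJ hch g hg hgS hp hA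

end Summit.AtomisticToContinuum.Crystallization.Theorems.SquareWellLayerCakeGapTwelveToBarlow

end
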